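/-
HONEST FRAMING: certified error envelopes and provably optimal rounding/accumulation schemes for
low-precision formats under stated cost models; every table by two implementations; no hardware or
vendor claims.
-/
import Summits.Ventures.CertifiedArithmetic.LowPrec.OptChainLabelsDR
import Summits.Ventures.CertifiedArithmetic.LowPrec.OptChainLabelsRNEConverse

/-!
# All-additions-double-rounded summation under round-to-nearest-EVEN: the regimes of T9(c)/(g)

T9(c) (`exact_le_doubleRounding`, `doubleRounding_attained`): recursive summation with every
addition rounded to nearest into the wide `F(q)` and at once into the narrow `F(p)` — the labelled
chain `q,p,q,p,…` — satisfies `acc + Σ a_i ≤ (1 + m(u_q + u_p)) · r_m` over nonnegative grid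
data, attained for every `m` by nearest maps resolving two families of ties suitably
(`TiesDownAtShift`, `TiesEvenAtPow`).  Certificate C21 (g) tabulated what IEEE round-to-nearest-
EVEN does: `q ≥ p+2` attains, `q = p+1` is strict, and with data confined to `F(p)` the witness
survives iff `q ≤ 2p-1`.  This file proves, for every `m`:

* `doubleRounding_rne_attained` — `q ≥ p+2`, `p ≥ 2`: EVERY pair of ties-to-even nearest maps
  attains `1 + m(u_q+u_p)` (ties-to-even implies both tie families: `tiesDownAtShift_of_tiesToEven`,
  `tiesEvenAtPow_of_tiesToEven`);
* `doubleRounding_rne_strict` — `q = p+1`: for EVERY pair of ties-to-even nearest maps, ALL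
  nonnegative grid data, any start value in some `F(e)` and every `m ≥ 1`,
  `acc + Σ a_i < (1 + m(u_q+u_p)) · r_m` whenever `r_m > 0` (an instance of the necessity half of
  the RNE criterion, `exact_lt_lchain_of_viol`: the conversion into `F(p)` is fed by the addition
  just before it at exactly one more bit);
* `isFloat_drSummand` — `p+1 ≤ q ≤ 2p-1`: the attaining summand `2^e(u_p+u_q)` is itself a
  `p`-bit float, so the constant is attained with data confined to `F(p)`.
Packaged as `R4_DoubleRoundingRNE_holds`.
-/

namespace Summit.Ventures.CertifiedArithmetic.LowPrec.Opt

open Literature.ComputerArithmetic.JeannerodRump2018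

/-! ## Ties-to-even implies the two tie families of the witness -/

/-- `2^e` is an even float of `F(p)` (`p ≥ 2`, `e ≥ emin + 1`). -/
theorem isEvenFloat_two_zpow {p : ℕ} {emin e : ℤ} (hp : 2 ≤ p) (he : emin + 1 ≤ e) :
    IsEvenFloat p emin ((2 : ℚ) ^ e) := by
  refine ⟨1, e, ?_, he, by simp⟩
  have : (1 : ℤ) < 2 ^ (p - 1) := one_lt_pow₀ (by norm_num) (by omega)
  simpa using this

/-- TIES-TO-EVEN ⇒ TIES-TO-EVEN AT THE BINADE POINTS: a ties-to-even nearest map into `F(p)`,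
`p ≥ 2`, sends every midpoint `2^e (1 + u_p)`, `e ≥ emin`, to `2^e`. -/
theorem tiesEvenAtPow_of_tiesToEven {p : ℕ} {emin : ℤ} {fl : ℚ → ℚ} (hp : 2 ≤ p)
    (hfl : IsRoundNearest p emin fl) (hte : TiesToEven p emin fl) : TiesEvenAtPow p emin fl := by
  intro e he
  rcases lt_or_eq_of_le he with hlt | heq
  · exact fl_midpoint_even (by omega) hfl hte (isEvenFloat_two_zpow hp (by omega)) le_rfl
  · -- `e = emin`: `2^emin (1 + u_p)` is within `2^(emin-p) < 2^emin / 2` of the grid point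
    -- `2^emin`, and every float is a grid point, so the nearest float is `2^emin` itself.
    subst heq
    have h2 : (2 : ℚ) ≠ 0 := by norm_num
    set t := (2 : ℚ) ^ emin + (2 : ℚ) ^ emin * unitRoundoff p with ht
    have hpos : (0 : ℚ) < (2 : ℚ) ^ emin := zpow_pos (by norm_num) _
    have hsmall : 4 * ((2 : ℚ) ^ emin * unitRoundoff p) ≤ (2 : ℚ) ^ emin := by
      have hu : unitRoundoff p ≤ 1 / 4 := by
        unfold unitRoundoff
        have h4 : (4 : ℚ) ≤ 2 ^ p := by
          calc (4 : ℚ) = 2 ^ 2 := by norm_num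
            _ ≤ 2 ^ p := pow_le_pow_right₀ (by norm_num) hp
        rw [div_le_div_iff₀ (by positivity) (by norm_num)]
        linarith
      nlinarith
    have hupos : 0 < (2 : ℚ) ^ emin * unitRoundoff p :=
      mul_pos hpos (by unfold unitRoundoff; positivity)
    obtain ⟨hF, hmin⟩ := hfl t
    have h1 : |t - fl t| ≤ (2 : ℚ) ^ emin * unitRoundoff p := by
      have := hmin _ (PTree.isFloat_two_zpow (by omega : 1 ≤ p) (le_refl emin))
      rwa [show t - (2 : ℚ) ^ emin = (2 : ℚ) ^ emin * unitRoundoff p by rw [ht]; ring,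
        abs_of_pos hupos] at this
    obtain ⟨N, hN⟩ := isGrid_of_isFloat hF
    obtain ⟨h1l, h1r⟩ := abs_le.mp h1
    rw [hN, ht] at h1l h1r
    have hNlo : ((N : ℤ) : ℚ) > 0 := by
      by_contra hle
      push Not at hle
      have : (N : ℚ) * (2 : ℚ) ^ emin ≤ 0 := mul_nonpos_of_nonpos_of_nonneg hle hpos.le
      linarith
    have hNhi : ((N : ℤ) : ℚ) < 2 := by
      by_contra hge
      push Not at hge
      have : 2 * (2 : ℚ) ^ emin ≤ (N : ℚ) * (2 : ℚ) ^ emin :=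
        mul_le_mul_of_nonneg_right hge hpos.le
      linarith
    have hN1 : N = 1 := by
      have a : (0 : ℤ) < N := by exact_mod_cast hNlo
      have b : N < (2 : ℤ) := by exact_mod_cast hNhi
      omega
    rw [hN, hN1]; simp

/-- `2^e (1 + u_p)` is an EVEN float of `F(q)` when `q ≥ p + 2` (`p ≥ 1`, `e ≥ emin + q - 1`):
its `q`-bit significand `2^(q-1) + 2^(q-1-p)` is even. -/
theorem isEvenFloat_shift {p q : ℕ} {emin e : ℤ} (hp : 1 ≤ p) (hpq : p + 2 ≤ q)
    (he : emin + q ≤ e + 1) :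
    IsEvenFloat q emin ((2 : ℚ) ^ e + (2 : ℚ) ^ e * unitRoundoff p) := by
  have h2 : (2 : ℚ) ≠ 0 := by norm_num
  refine ⟨2 ^ (q - 2) + 2 ^ (q - 2 - p), e + 2 - q, ?_, by omega, ?_⟩
  · rw [abs_of_pos (by positivity)]
    have h1 : (2 : ℤ) ^ (q - 2 - p) < 2 ^ (q - 2) := pow_lt_pow_right₀ (by norm_num) (by omega)
    have h3 : (2 : ℤ) ^ (q - 1) = 2 ^ (q - 2) + 2 ^ (q - 2) := by
      rw [show q - 1 = (q - 2) + 1 by omega, pow_succ]; ring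
    omega
  · rw [two_zpow_mul_unitRoundoff]
    push_cast
    rw [add_mul, ← zpow_natCast, ← zpow_natCast, ← zpow_add₀ h2, ← zpow_add₀ h2]
    congr 2
    · push_cast [Nat.cast_sub (show 2 ≤ q by omega)]; ring
    · push_cast [Nat.cast_sub (show p ≤ q - 2 by omega), Nat.cast_sub (show 2 ≤ q by omega)]; ring

/-- TIES-TO-EVEN ⇒ TIES DOWN AT THE SHIFTED MIDPOINTS when `q ≥ p + 2`: a ties-to-even nearest
map into `F(q)` sends `2^e (1 + u_p + u_q)`, `e ≥ emin + q`, to the even candidate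
`2^e (1 + u_p)`. -/
theorem tiesDownAtShift_of_tiesToEven {p q : ℕ} {emin : ℤ} {fl : ℚ → ℚ} (hp : 1 ≤ p)
    (hpq : p + 2 ≤ q) (hfl : IsRoundNearest q emin fl) (hte : TiesToEven q emin fl) :
    TiesDownAtShift p q emin fl := by
  intro e he
  have hv := isEvenFloat_shift (emin := emin) (e := e) hp hpq (by omega)
  have hle : (2 : ℚ) ^ e ≤ (2 : ℚ) ^ e + (2 : ℚ) ^ e * unitRoundoff p :=
    le_add_of_nonneg_right (mul_nonneg (zpow_pos (by norm_num) _).le (unitRoundoff_nonneg p))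
  exact fl_midpoint_even (by omega) hfl hte hv hle

/-! ## The regimes -/

/-- `q ≥ p + 2`, ROUND-TO-NEAREST-EVEN ATTAINS the double-rounding constant for every `m`
(T9(c)/(g)): with ANY ties-to-even nearest maps into `F(q)` and `F(p)` (`p ≥ 2`), accumulator
`2^e` and `m` summands `2^e (u_p + u_q) ∈ F(q)` (`e ≥ emin + q`) the double-rounded running sum
never moves: `2^e + Σ a_i = (1 + m (u_q + u_p)) · r_m`, `r_m = 2^e`. -/
theorem doubleRounding_rne_attained {p q : ℕ} (hp : 2 ≤ p) (hpq : p + 2 ≤ q) {emin : ℤ}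
    {flq flp : ℚ → ℚ} (hflq : IsRoundNearest q emin flq) (hteq : TiesToEven q emin flq)
    (hflp : IsRoundNearest p emin flp) (htep : TiesToEven p emin flp) {e : ℤ}
    (he : emin + q ≤ e) (m : ℕ) :
    let ys := List.replicate m ((2 : ℚ) ^ e * unitRoundoff p + (2 : ℚ) ^ e * unitRoundoff q)
    lchainEval ((2 : ℚ) ^ e) (drSteps q p flq flp ys) = (2 : ℚ) ^ e ∧
    (2 : ℚ) ^ e + ys.sum = (1 + (m : ℚ) * (unitRoundoff q + unitRoundoff p)) *
      lchainEval ((2 : ℚ) ^ e) (drSteps q p flq flp ys) :=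
  doubleRounding_attained (tiesDownAtShift_of_tiesToEven (by omega) hpq hflq hteq)
    (tiesEvenAtPow_of_tiesToEven hp hflp htep) he m

/-- The steps of a double-rounding chain are additions at `(q, flq)` or conversions at `(p, flp)`. -/
theorem mem_drSteps {q p : ℕ} {flq flp : ℚ → ℚ} :
    ∀ {ys : List ℚ} {s : LStep}, s ∈ drSteps q p flq flp ys →
      (s.prec = q ∧ s.fl = flq) ∨ (s.prec = p ∧ s.fl = flp)
  | [], _, hs => by simp at hs
  | y :: ys, s, hs => by
      rw [drSteps_cons, List.mem_cons, List.mem_cons] at hs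
      rcases hs with rfl | rfl | hs
      · exact Or.inl ⟨rfl, rfl⟩
      · exact Or.inr ⟨rfl, rfl⟩
      · exact mem_drSteps hs

/-- `q = p + 1`, ROUND-TO-NEAREST-EVEN IS STRICT for every `m ≥ 1` and ALL data (T9(c)/(g)):
with ANY ties-to-even nearest maps into `F(p+1)` and `F(p)`, any start value `acc ≥ 0` lying in
some `F(e)`, and any nonnegative grid summands, `acc + Σ a_i < (1 + m (u_{p+1} + u_p)) · r_m`
whenever `r_m > 0` — the conversion into `F(p)` is fed by the addition just before it at exactly
one more bit, a violation of the RNE criterion (`exact_lt_lchain_of_viol`). -/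
theorem doubleRounding_rne_strict {p : ℕ} (hp1 : 1 ≤ p) {emin : ℤ} {flq flp : ℚ → ℚ}
    (hflq : IsRoundNearest (p + 1) emin flq) (hteq : TiesToEven (p + 1) emin flq)
    (hflp : IsRoundNearest p emin flp) (htep : TiesToEven p emin flp)
    {e : ℕ} (acc : ℚ) (hacc0 : 0 ≤ acc) (haccF : IsFloat e emin acc)
    (y : ℚ) (ys : List ℚ) (hys : ∀ z ∈ y :: ys, 0 ≤ z ∧ IsGrid emin z)
    (hpos : 0 < lchainEval acc (drSteps (p + 1) p flq flp (y :: ys))) :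
    acc + (y :: ys).sum <
      (1 + ((y :: ys).length : ℚ) * (unitRoundoff (p + 1) + unitRoundoff p)) *
        lchainEval acc (drSteps (p + 1) p flq flp (y :: ys)) := by
  have hv : Viol e (drSteps (p + 1) p flq flp (y :: ys)) := by
    rw [drSteps_cons]
    exact Or.inr (Or.inl ⟨rfl, rfl⟩)
  have hss : ∀ s ∈ drSteps (p + 1) p flq flp (y :: ys), s.OK emin ∧ TiesToEven s.prec emin s.fl := by
    intro s hs
    refine ⟨drSteps_ok (by omega) hp1 hflq hflp _ hys s hs, ?_⟩
    rcases mem_drSteps hs with ⟨h1, h2⟩ | ⟨h1, h2⟩ <;> (rw [h1, h2]; assumption)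
  rw [← xsum_drSteps (p + 1) p flq flp (y :: ys), ← usum_drSteps (p + 1) p flq flp (y :: ys)]
  exact exact_lt_lchain_of_viol _ acc hacc0 haccF hss hv hpos

/-- DATA CONFINED TO `F(p)` (T9(c)/(g)): for `p + 1 ≤ q ≤ 2p - 1` the attaining summand
`2^e (u_p + u_q) = (2^(q-p) + 1) · 2^(e-q)` is a `p`-bit float (`e ≥ emin + q`), so the
double-rounding constant is attained with all data in the NARROW format. -/
theorem isFloat_drSummand {p q : ℕ} {emin e : ℤ} (hpq : p + 1 ≤ q) (hq : q + 1 ≤ 2 * p)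
    (he : emin + q ≤ e) :
    IsFloat p emin ((2 : ℚ) ^ e * unitRoundoff p + (2 : ℚ) ^ e * unitRoundoff q) := by
  have h2 : (2 : ℚ) ≠ 0 := by norm_num
  refine ⟨2 ^ (q - p) + 1, e - q, ?_, by omega, ?_⟩
  · rw [abs_of_pos (by positivity)]
    have h1 : (2 : ℤ) ^ (q - p) ≤ 2 ^ (p - 1) := pow_le_pow_right₀ (by norm_num) (by omega)
    have h3 : (2 : ℤ) ^ p = 2 ^ (p - 1) + 2 ^ (p - 1) := by
      have h5 : (2 : ℤ) ^ ((p - 1) + 1) = 2 ^ (p - 1) * 2 := pow_succ 2 (p - 1)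
      rw [show p - 1 + 1 = p by omega] at h5
      omega
    have h4 : (1 : ℤ) < 2 ^ (p - 1) := one_lt_pow₀ (by norm_num) (by omega)
    omega
  · rw [two_zpow_mul_unitRoundoff, two_zpow_mul_unitRoundoff]
    push_cast
    rw [add_mul, one_mul, ← zpow_natCast, ← zpow_add₀ h2]
    congr 2
    push_cast [Nat.cast_sub (show p ≤ q by omega)]; ring

/-- … and then the attained equality of T9(c) holds with every datum in `F(p)`. -/
theorem doubleRounding_attained_narrowData {p q : ℕ} (hpq : p + 1 ≤ q) (hq : q + 1 ≤ 2 * p)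
    {emin : ℤ} {flq flp : ℚ → ℚ} (hT : TiesDownAtShift p q emin flq) (hE : TiesEvenAtPow p emin flp)
    {e : ℤ} (he : emin + q ≤ e) (m : ℕ) :
    let ys := List.replicate m ((2 : ℚ) ^ e * unitRoundoff p + (2 : ℚ) ^ e * unitRoundoff q)
    (∀ y ∈ ys, IsFloat p emin y) ∧ IsFloat p emin ((2 : ℚ) ^ e) ∧
    lchainEval ((2 : ℚ) ^ e) (drSteps q p flq flp ys) = (2 : ℚ) ^ e ∧
    (2 : ℚ) ^ e + ys.sum = (1 + (m : ℚ) * (unitRoundoff q + unitRoundoff p)) *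
      lchainEval ((2 : ℚ) ^ e) (drSteps q p flq flp ys) := by
  intro ys
  refine ⟨fun y hy => ?_, PTree.isFloat_two_zpow (by omega) (by omega),
    doubleRounding_attained hT hE he m⟩
  rw [List.eq_of_mem_replicate hy]
  exact isFloat_drSummand hpq hq he

/-! ## Registered form -/

/-- ALL-ADDITIONS-DOUBLE-ROUNDED SUMMATION UNDER ROUND-TO-NEAREST-EVEN, THE REGIMES (OPTIMA.md §B,
T9(c)/(g); certificate C21 (g)): (1) `q ≥ p+2`, `p ≥ 2`: every pair of ties-to-even nearest maps
attains `1 + m(u_q+u_p)` for every `m` (witness `2^e`, `m × 2^e(u_p+u_q)`); (2) `q = p+1`: every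
pair of ties-to-even nearest maps is STRICT for every `m ≥ 1`, all nonnegative grid data and any
start value in some `F(e)`; (3) `p+1 ≤ q ≤ 2p-1`: the witness data lie in `F(p)`. -/
def R4_DoubleRoundingRNE : Prop :=
  (∀ (p q : ℕ) (emin : ℤ) (flq flp : ℚ → ℚ), 2 ≤ p → p + 2 ≤ q →
    IsRoundNearest q emin flq → TiesToEven q emin flq →
    IsRoundNearest p emin flp → TiesToEven p emin flp →
    ∀ (e : ℤ) (m : ℕ), emin + q ≤ e →
      (2 : ℚ) ^ e + (List.replicate m ((2 : ℚ) ^ e * unitRoundoff p +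
          (2 : ℚ) ^ e * unitRoundoff q)).sum =
        (1 + (m : ℚ) * (unitRoundoff q + unitRoundoff p)) *
          lchainEval ((2 : ℚ) ^ e) (drSteps q p flq flp (List.replicate m
            ((2 : ℚ) ^ e * unitRoundoff p + (2 : ℚ) ^ e * unitRoundoff q)))) ∧
  (∀ (p : ℕ) (emin : ℤ) (flq flp : ℚ → ℚ), 1 ≤ p →
    IsRoundNearest (p + 1) emin flq → TiesToEven (p + 1) emin flq →
    IsRoundNearest p emin flp → TiesToEven p emin flp →
    ∀ (e : ℕ) (acc : ℚ) (ys : List ℚ), ys ≠ [] → 0 ≤ acc → IsFloat e emin acc →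
      (∀ z ∈ ys, 0 ≤ z ∧ IsGrid emin z) → 0 < lchainEval acc (drSteps (p + 1) p flq flp ys) →
      acc + ys.sum < (1 + (ys.length : ℚ) * (unitRoundoff (p + 1) + unitRoundoff p)) *
        lchainEval acc (drSteps (p + 1) p flq flp ys)) ∧
  (∀ (p q : ℕ) (emin e : ℤ), p + 1 ≤ q → q + 1 ≤ 2 * p → emin + q ≤ e →
    IsFloat p emin ((2 : ℚ) ^ e * unitRoundoff p + (2 : ℚ) ^ e * unitRoundoff q))

/-- `R4_DoubleRoundingRNE` holds. -/
theorem R4_DoubleRoundingRNE_holds : R4_DoubleRoundingRNE := by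
  refine ⟨?_, ?_, fun p q emin e hpq hq he => isFloat_drSummand hpq hq he⟩
  · intro p q emin flq flp hp hpq hflq hteq hflp htep e m he
    exact (doubleRounding_rne_attained hp hpq hflq hteq hflp htep he m).2
  · intro p emin flq flp hp1 hflq hteq hflp htep e acc ys hne hacc0 haccF hys hpos
    cases ys with
    | nil => exact absurd rfl hne
    | cons y ys => exact doubleRounding_rne_strict hp1 hflq hteq hflp htep acc hacc0 haccF y ys hys hpos

end Summit.Ventures.CertifiedArithmetic.LowPrec.Opt
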